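import Literature.MathematicalPhysics.QuantumFieldTheory.Balaban1983to89.B8IdxB8LamTopOfTowerDisjoint
import Literature.MathematicalPhysics.QuantumFieldTheory.Balaban1983to89.Node00.CarriersB8SubD

/-!
# `Balaban1983to89.B8TowerBondsLayerLawSubD` — [Balaban1985RegularSpaces] (1.3)–(1.6) p. 77 ON THE (1.5)-OBEYING LEAF INDEX `Node00.IdxB8SubD θ` («P₂D»): THE LAYER LAW,
# THE P-CLASS LAW `LevelSepPP`, dag-n06-b's AVERAGING BINDERS AND TOP-TOWER DISJOINTNESS HOLD OUTRIGHT — no displayed geometric clause left (faces, by name)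

statement-level skeleton of published theorems with citation tags; proofs where landed; nothing here is a claim about the Yang–Mills mass gap

T. Bałaban, *Spaces of regular gauge field configurations on a lattice and gauge fixing conditions*, Commun. Math. Phys. **99** (1985) 75–102
`[Balaban1985RegularSpaces]` ("B8"; journal page = PDF page + 74): (1.3)–(1.6) p. 77, (1.19) p. 79 ∕ (1.34) p. 82, (1.31) p. 82, (1.68) p. 88, (1.131) p. 99.  T. Bałaban, *Propagators
and renormalization transformations for lattice gauge theories. II*, Commun. Math. Phys. **96** (1984) 223–250 `[Balaban1984PropagatorsII]` ("B6"), (2.1)–(2.3) p. 224.  T. Bałaban,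
*Propagators for lattice gauge theories in a background field*, Commun. Math. Phys. **99** (1985) 389–434 `[Balaban1985BackgroundPropagators]` ([4]), (3.16) p. 393.

## WHY THIS FILE (cell `pub-ymgap`, HUMAN RULING D-0062 ∕ D-0149; DAG node N05 = [B8] (edge N06 → N05); width seat `pub-ymgap-dag-n05-w2` g3; proof lane, count-neutral)

The «P₂D» re-index (dag-n05-c g15 DESIGN WORD; dag-n05-d; dag-n05-w1 `Node00/CarriersB8SubD`, p615695) keys N05's leaf on the (1.5)-OBEYING admissible sub-index
`IdxB8SubD θ = {j : IdxB8SubC θ ∕∕ ∀ l < k, ∀ z ∈ Λs k l, Lˡ•z ∈ Lam L Ω l}` — the Subtype by exactly the `hΛ` text under which this lineage (p609116 ∕ p611723) derived the layer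
law (L2) and the averaging-binder class law, and under which dag-n05-c derived top-tower disjointness (p613464; equivalent to it, p617040).  On `IdxB8SubD` that text is a
FIELD (`j.2`), as are the located laws (`j.1.1.2`) and the (1.3)–(1.4) record (`j.1.2`): so every one of those consequences holds there OUTRIGHT.  THIS FILE packages them BY NAME for
the P₂D knits and the letter providers — at a member `j : IdxB8SubD θ` there is nothing left to thread (`hcolU`, `hlay`, `hΛ`, `hdisj` all gone); the only remaining hypotheses of the
binder faces are the binder's own data (`τ`, `C_τ`, `ops₀`, `M`, `m`) and `2 ≤ θ.D`.

## WHAT IS PROVED (kernel, 0 sorry; one-line faces)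

`IdxB8SubD.layerLaw` ((L2) at every truncation `m ≤ k`) · ★★ `IdxB8SubD.levelSepPP_towerBondsP` (`∀ m ≤ k`, `LevelSepPP θ.L m j.Ω (fun m' l => towerBondsP θ.L j.Ω (j.Λs m') l) 1`
— print's class (1.31), box `⊂ Ω_{l−1}`, unit collar) · `IdxB8SubD.levelSepPP_towerBondsP_trunc` (truncated class map, every `m`) · ★ `IdxB8SubD.avgAtP_withQQP_towerBondsP_trunc` ∕
★ `IdxB8SubD.avgAtγ_withQQP_towerBondsP_trunc` (dag-n06-b's genuine-letter binders `AvgAtP` ∕ `AvgAtγ` at print's class of the member's truncated towers, every `m`; `2 ≤ θ.D`) ·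
★ `IdxB8SubD.towersDisjoint` (pairwise-disjoint constraint towers at EVERY truncation `m ≤ k`, dag-n05-c's `towers_disjoint_of_lamTop`) · `IdxB8SubD.towersDisjoint_top` ·
`IdxB8SubD.towersDisjoint_inBox` ∕ `IdxB8SubD.towersDisjoint_blockMap` (the `ZdIdx.htower` ∕ `Q′_j`-label spellings).

## HONEST SCOPE

By-name faces on a landed index; lattice bookkeeping; NO estimate of [Balaban1985RegularSpaces] ∕ [4] is proved or asserted; whether [4]'s letters ∕ the b9 sockets EXIST at
`IdxB8SubD` members is [4] Thm 3.1 ∕ 3.3's business (N06), untouched; the index is inhabited at every depth (`Node00.exists_idxB8SubD_depth`, print's pinned tower of p611723), so no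
face here is vacuous.  Count-neutral; N05 ∕ N06 NOT discharged; no count claim (the chair's single count line is the only count); `T_η ↦ ℤᵈ`; one finite `𝕋⁴` programme at fixed `ε`,
Bałaban AS PRINTED; the Yang–Mills mass gap (Clay) is NOT proved by any of this — R4 closes the conditional finite-`𝕋⁴` rung `BalabanLadder.UV` only; nothing continuum ∕ ℝ⁴ ∕ OS.
No `sorry`, no `def`, no `instance`, no `notation`.  Unit `pub-ymgap-dag-n05-w2` (g3), 2026-08-28.

RELATED IN THE TREE, NOT DUPLICATED: `Node00/CarriersB8SubD` (dag-n05-w1: the index, its (1.3)∕(1.4)∕(1.5) faces, inhabitation — USED), `B8TowerBondsLayerLawSubC` (this seat: the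
`IdxB8SubC` faces under `hΛ` — USED), `B8TowerBondsLayerLawOfLam` (dag-n05-w6), `B8TowerBondsLevelSep` (this seat g2: the class-law lemma), `B8IdxB8LamTopTowerDisjoint` (dag-n05-c: disjointness
from (1.5) — USED), `B8IdxB8LamTopOfTowerDisjoint` (this seat: the converse ∕ iff), `B9Eq316AveragingTransposeZdPrinted` (dag-n06-b: `LevelSepPP`, the binders).

[cite: Balaban1985RegularSpaces, (1.3)–(1.6) p.77, (1.19) p.79, (1.31) p.82, (1.34) p.82, (1.68) p.88, (1.131) p.99; Balaban1984PropagatorsII, (2.1)–(2.3) p.224;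
Balaban1985BackgroundPropagators, (3.16) p.393]
-/

noncomputable section

namespace Literature.MathematicalPhysics.QuantumFieldTheory.Balaban1983to89.B8TowerBondsLayerLawSubD

open Literature.MathematicalPhysics.QuantumLattice (blockMap)
open B7Prop1Explicit B7Prop1Local
open B8Ineq132 (Under)
open B8Ineq130 (tlo thi)
open B8LeafModelZd (ZdIdx)
open B8TowerBondsPrinted (towerBondsP)
open B9Eq316AveragingTransposeZdPrinted (LevelSepPP)
open B8TowerBondsLayerLawSubC (IdxB8SubC.layerLaw_of_lamTop IdxB8SubC.levelSepPP_towerBondsP_of_lamTop IdxB8SubC.levelSepPP_towerBondsP_trunc_of_lamTop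
  IdxB8SubC.avgAtP_withQQP_towerBondsP_trunc_of_lamTop IdxB8SubC.avgAtγ_withQQP_towerBondsP_trunc_of_lamTop)
open B8IdxB8LamTopTowerDisjoint (towers_disjoint_of_lamTop towers_disjoint_top_of_lamTop towers_disjoint_of_lamTop_inBox towers_disjoint_of_lamTop_blockMap)
open Node00 (Stage3Params IdxB8SubD)

/-- `1 ≤ θ.L` (Bałaban's block size is odd `> 1`; private plumbing). [folklore] -/
private theorem one_le_L (θ : Stage3Params) : 1 ≤ θ.L := le_trans (by norm_num) θ.two_le_L

variable {θ : Stage3Params}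

/-! ## §1 The layer law and the P-class law on `IdxB8SubD`, outright -/

/-- **(L2) ON THE (1.5)-OBEYING LEAF INDEX, OUTRIGHT**: at every member `j : IdxB8SubD θ` and every truncation `m ≤ k`, every site of the `l`-block of a point of `Λs m l` (`l < m`) lies
outside `Ω_{l+1}` (the `hlay` of `B8TowerBondsLevelSep`; `IdxB8SubC.layerLaw_of_lamTop` at the field `j.2`). [cite: Balaban1985RegularSpaces, (1.5) p.77, (1.4) p.77, (1.19) p.79, (1.34) p.82] -/
theorem IdxB8SubD.layerLaw (j : IdxB8SubD θ) :
    ∀ m, m ≤ j.1.1.1.1.k → ∀ l, l < m → ∀ z ∈ j.1.1.1.1.Λs m l, ∀ x, Under θ.L l z x → x ∉ j.1.1.1.1.Ω (l + 1) :=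
  IdxB8SubC.layerLaw_of_lamTop j.1 j.2

/-- ★★ **THE P-CLASS LAW ON THE (1.5)-OBEYING LEAF INDEX, OUTRIGHT**: at every member `j : IdxB8SubD θ` and every truncation `m ≤ k`,
`LevelSepPP θ.L m j.Ω (fun m' l => towerBondsP θ.L j.Ω (j.Λs m') l) 1` — print's class (1.31), box `⊂ Ω_{l−1}`, unit collar — with NO hypothesis.
[cite: Balaban1985RegularSpaces, (1.31) p.82, (1.3)–(1.5) p.77; Balaban1984PropagatorsII, (2.1)–(2.3) p.224] -/
theorem IdxB8SubD.levelSepPP_towerBondsP (j : IdxB8SubD θ) :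
    ∀ m, m ≤ j.1.1.1.1.k → LevelSepPP θ.L m j.1.1.1.1.Ω (fun m' l => towerBondsP θ.L j.1.1.1.1.Ω (j.1.1.1.1.Λs m') l) 1 :=
  IdxB8SubC.levelSepPP_towerBondsP_of_lamTop j.1 j.2

/-- **The same through the TRUNCATED class map, every `m`** (dag-n06-b's junk-level recipe; vacuous above `k`).
[cite: Balaban1985RegularSpaces, (1.31) p.82, (1.68) p.88; Balaban1984PropagatorsII, (2.3) p.224] -/
theorem IdxB8SubD.levelSepPP_towerBondsP_trunc (j : IdxB8SubD θ) (m : ℕ) :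
    LevelSepPP θ.L m j.1.1.1.1.Ω (fun m' l => if m' ≤ j.1.1.1.1.k then towerBondsP θ.L j.1.1.1.1.Ω (j.1.1.1.1.Λs m') l else ∅) 1 :=
  IdxB8SubC.levelSepPP_towerBondsP_trunc_of_lamTop j.1 j.2 m

/-! ## §2 dag-n06-b's averaging binders at print's class of a P₂D member, outright -/

section Binder

variable {𝔸 : Type*} [CStarAlgebra 𝔸] (τ : 𝔸 →ₗ[ℂ] ℂ) [FiniteDimensional ℝ 𝔸] [Nontrivial 𝔸]

open B9SupplySockB9P3ZdLetters (OpsZd)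
open B9SupplySockB9P3ZdGammaUniv (AvgAtP)
open B9SupplySockB9P3ZdGamma (AvgAtγ)
open B9Eq316AveragingTransposeZd (qQ betaTau)
open B9Eq316AveragingTransposeZdPrinted (withQQP)

/-- ★ **THE GENUINE-LETTER `AvgAtP` BINDER AT PRINT'S CLASS OF A P₂D MEMBER, OUTRIGHT** (`2 ≤ θ.D`; every truncation `m` through the truncated class map; constant
`qQ θ.D θ.L C_τ β_τ 1`): no geometric hypothesis — the member's fields supply `IdxB8Laws`, `DomainSeq` and the (1.5) reading.
[cite: Balaban1985BackgroundPropagators, (3.16) p.393; Balaban1985RegularSpaces, (1.56), (1.58) p.86, (1.31) p.82, (1.3)–(1.5) p.77, (1.68) p.88] -/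
theorem IdxB8SubD.avgAtP_withQQP_towerBondsP_trunc (hD : 2 ≤ θ.D)
    {Cτ : ℝ} (hCτ : ∀ x y : 𝔸, |(τ (star x * y)).re| ≤ Cτ * ‖x‖ * ‖y‖)
    (ops₀ : ℝ → ZdIdx θ.D θ.L → ℕ → OpsZd θ.D 𝔸) (M : ℝ) (j : IdxB8SubD θ) (m : ℕ) :
    AvgAtP θ.L (withQQP τ θ.L (fun m' l => if m' ≤ j.1.1.1.1.k then towerBondsP θ.L j.1.1.1.1.Ω (j.1.1.1.1.Λs m') l else ∅) ops₀) (qQ θ.D θ.L Cτ (betaTau τ) 1)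
      (fun m' l => if m' ≤ j.1.1.1.1.k then towerBondsP θ.L j.1.1.1.1.Ω (j.1.1.1.1.Λs m') l else ∅) M j.1.1.1.1 m :=
  IdxB8SubC.avgAtP_withQQP_towerBondsP_trunc_of_lamTop τ hD hCτ ops₀ M j.1 j.2 m

/-- ★ **The same in the γ currency** (`AvgAtγ`, the binder of the γ suppliers `sockB9P3D4γ(I)_at`), outright.
[cite: Balaban1985BackgroundPropagators, (3.16) p.393; Balaban1985RegularSpaces, (1.56), (1.58) p.86, (1.31) p.82, (1.3)–(1.5) p.77, (1.68) p.88] -/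
theorem IdxB8SubD.avgAtγ_withQQP_towerBondsP_trunc (hD : 2 ≤ θ.D)
    {Cτ : ℝ} (hCτ : ∀ x y : 𝔸, |(τ (star x * y)).re| ≤ Cτ * ‖x‖ * ‖y‖)
    (ops₀ : ℝ → ZdIdx θ.D θ.L → ℕ → OpsZd θ.D 𝔸) (M : ℝ) (j : IdxB8SubD θ) (m : ℕ) :
    AvgAtγ θ.L (withQQP τ θ.L (fun m' l => if m' ≤ j.1.1.1.1.k then towerBondsP θ.L j.1.1.1.1.Ω (j.1.1.1.1.Λs m') l else ∅) ops₀) (qQ θ.D θ.L Cτ (betaTau τ) 1)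
      (fun m' l => if m' ≤ j.1.1.1.1.k then towerBondsP θ.L j.1.1.1.1.Ω (j.1.1.1.1.Λs m') l else ∅) M j.1.1.1.1 m :=
  IdxB8SubC.avgAtγ_withQQP_towerBondsP_trunc_of_lamTop τ hD hCτ ops₀ M j.1 j.2 m

end Binder

/-! ## §3 Pairwise-disjoint constraint towers on `IdxB8SubD`, outright (dag-n05-c's `towers_disjoint_of_lamTop` at the field `j.2`) -/

/-- ★ **PAIRWISE-DISJOINT CONSTRAINT TOWERS AT EVERY TRUNCATION `m ≤ k`, OUTRIGHT** («Ω_j^{(j)} = ⋃_{l≥j} B^{l−j}(Λ_l)» as a partition, carried down the truncations by №8): two towers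
`Bˡ(z)`, `Bˡ′(z′)` (`z ∈ Λs m l`, `z′ ∈ Λs m l′`, `l, l′ ≤ m`) sharing a fine site have `l = l′` and `z = z′`. [cite: Balaban1985RegularSpaces, (1.5)–(1.6) p.77, (1.19) p.79, (1.34) p.82] -/
theorem IdxB8SubD.towersDisjoint (j : IdxB8SubD θ) :
    ∀ m, m ≤ j.1.1.1.1.k → ∀ l, l ≤ m → ∀ l', l' ≤ m → ∀ z ∈ j.1.1.1.1.Λs m l, ∀ z' ∈ j.1.1.1.1.Λs m l', ∀ x,
      Under θ.L l z x → Under θ.L l' z' x → l = l' ∧ z = z' :=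
  towers_disjoint_of_lamTop (one_le_L θ) j.1.1.1.1 j.1.1.2.toIdxB8Laws j.1.2 j.2

/-- **At the top truncation `m = k`.** [cite: Balaban1985RegularSpaces, (1.5)–(1.6) p.77] -/
theorem IdxB8SubD.towersDisjoint_top (j : IdxB8SubD θ) :
    ∀ l, l ≤ j.1.1.1.1.k → ∀ l', l' ≤ j.1.1.1.1.k → ∀ z ∈ j.1.1.1.1.Λs j.1.1.1.1.k l, ∀ z' ∈ j.1.1.1.1.Λs j.1.1.1.1.k l', ∀ x,
      Under θ.L l z x → Under θ.L l' z' x → l = l' ∧ z = z' :=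
  towers_disjoint_top_of_lamTop (one_le_L θ) j.1.1.1.1 j.1.1.2.toIdxB8Laws j.1.2 j.2

/-- **Tower-box spelling** (`InBox (tlo L z l) (thi L z l) x`, the text of `ZdIdx.htower`), every truncation. [cite: Balaban1985RegularSpaces, (1.5)–(1.6) p.77] -/
theorem IdxB8SubD.towersDisjoint_inBox (j : IdxB8SubD θ) :
    ∀ m, m ≤ j.1.1.1.1.k → ∀ l, l ≤ m → ∀ l', l' ≤ m → ∀ z ∈ j.1.1.1.1.Λs m l, ∀ z' ∈ j.1.1.1.1.Λs m l', ∀ x,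
      InBox (tlo θ.L z l) (thi θ.L z l) x → InBox (tlo θ.L z' l') (thi θ.L z' l') x → l = l' ∧ z = z' :=
  towers_disjoint_of_lamTop_inBox (one_le_L θ) j.1.1.1.1 j.1.1.2.toIdxB8Laws j.1.2 j.2

/-- **Block-label spelling** (`blockMap (L^l) x = z`, the reading of the `Q′_l`-constraints), every truncation. [cite: Balaban1985RegularSpaces, (1.5)–(1.6) p.77; Balaban1985BackgroundPropagators, (3.16) p.393] -/
theorem IdxB8SubD.towersDisjoint_blockMap (j : IdxB8SubD θ) :
    ∀ m, m ≤ j.1.1.1.1.k → ∀ l, l ≤ m → ∀ l', l' ≤ m → ∀ z ∈ j.1.1.1.1.Λs m l, ∀ z' ∈ j.1.1.1.1.Λs m l', ∀ x,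
      blockMap (θ.L ^ l) x = z → blockMap (θ.L ^ l') x = z' → l = l' ∧ z = z' :=
  towers_disjoint_of_lamTop_blockMap (one_le_L θ) j.1.1.1.1 j.1.1.2.toIdxB8Laws j.1.2 j.2

end Literature.MathematicalPhysics.QuantumFieldTheory.Balaban1983to89.B8TowerBondsLayerLawSubD

end
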